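import Literature.Computability.AlgebraicComplexity.TavenasVnWitness
import Literature.Computability.AlgebraicComplexity.SetMultilinear
import Summits.ValiantsHypothesis.ValiantsHypothesis.Theorems.FeketeSOSSOSMagnificationStubDigitKronecker

/-!
# Crux `SOSTau.HutchinsonMagnification` (stmt-ValiantsHypothesis-18749), line `SketchWitness`: stub T2 `stub_kroneckerHex`

The level-`m` HEX DIGIT LIFT of the Tavenas–Hutchinson polynomial `V_{4m} = tavenasV (4m)`,
`P_m = Σ_{i < 16^m} C (2^{vExp (4m) i}) · Π_{j<m} y_{(j, i / 16^j % 16)} ∈ ℂ[y_{(j,h)} : j < m, h < 16]`,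
is set-multilinear over the `m` digit blocks, has total degree exactly `m` (the monomial of `i = 0` has coefficient
`2^0 = 1 ≠ 0`), and the inverse Kronecker substitution `κ : y_{(j,h)} ↦ X^{h·16^j}` maps it to `V_{4m}` over `ℂ`.
Everything follows from the landed GENERIC digit-lift lemmas of `FeketeSOSSOSMagnificationStubDigitKronecker`
(`dk_isSetMultilinear_lift`, `dk_totalDegree_lift`, `dk_aeval_lift`, `dk_sum_digit_mul_pow`, any coefficient sequence),
`16^m = 2^{4m}` and the expansion `map_tavenasV'` of `V_n` over `ℂ` (Dutta 2021, Lemma 4, the map `ψ`; Tavenas 2014 §3).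

References: P. Dutta, *Real τ-conjecture for sum-of-squares: a unified approach to lower bound and derandomization*,
CSR 2021 (LNCS 12730), Lemma 4; S. Tavenas, thèse (2014), Lemme 3.36.
-/

noncomputable section

set_option linter.dupNamespace false

open MvPolynomial Finset
open Literature.Computability.AlgebraicComplexity
open Summit.ValiantsHypothesis.ValiantsHypothesis.Theorems.FeketeSOSSOSMagnification
  (dk_isSetMultilinear_lift dk_totalDegree_lift dk_aeval_lift dk_sum_digit_mul_pow)

namespace Summit.ValiantsHypothesis.ValiantsHypothesis.Theorems.SOSTauHutchinsonMagnification

/-- **Stub T2 `stub_kroneckerHex` of line `SketchWitness` (crux stmt-ValiantsHypothesis-18749).** The hex digit lift of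
`V_{4m}` is set-multilinear over the `m` blocks `Prod.fst`, has total degree exactly `m`, and the inverse Kronecker
substitution `y_{(j,h)} ↦ X^{h·16^j}` maps it to `(tavenasV (4m)).map (Int.castRingHom ℂ)`. -/
theorem stub_kroneckerHex :
    ∀ m : ℕ,
      IsSetMultilinear (Prod.fst : Fin m × Fin 16 → Fin m) Finset.univ
        (∑ i ∈ Finset.range (16 ^ m), C ((2 : ℂ) ^ vExp (4 * m) i) *
          ∏ j : Fin m, X (j, (⟨i / 16 ^ (j : ℕ) % 16, Nat.mod_lt _ (by norm_num)⟩ : Fin 16)) :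
            MvPolynomial (Fin m × Fin 16) ℂ) ∧
      (∑ i ∈ Finset.range (16 ^ m), C ((2 : ℂ) ^ vExp (4 * m) i) *
          ∏ j : Fin m, X (j, (⟨i / 16 ^ (j : ℕ) % 16, Nat.mod_lt _ (by norm_num)⟩ : Fin 16)) :
            MvPolynomial (Fin m × Fin 16) ℂ).totalDegree = m ∧
      MvPolynomial.aeval (fun v : Fin m × Fin 16 => (Polynomial.X : Polynomial ℂ) ^ ((v.2 : ℕ) * 16 ^ (v.1 : ℕ)))
          (∑ i ∈ Finset.range (16 ^ m), C ((2 : ℂ) ^ vExp (4 * m) i) *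
            ∏ j : Fin m, X (j, (⟨i / 16 ^ (j : ℕ) % 16, Nat.mod_lt _ (by norm_num)⟩ : Fin 16)) :
              MvPolynomial (Fin m × Fin 16) ℂ) =
        (tavenasV (4 * m)).map (Int.castRingHom ℂ) := by
  intro m
  have hdig : ∀ i ∈ Finset.range (16 ^ m),
      ∑ j : Fin m, (((⟨i / 16 ^ (j : ℕ) % 16, Nat.mod_lt _ (by norm_num)⟩ : Fin 16) : ℕ)) * 16 ^ (j : ℕ) = i :=
    fun i hi => dk_sum_digit_mul_pow 16 (by norm_num) m i (Finset.mem_range.1 hi)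
  refine ⟨dk_isSetMultilinear_lift m 16 _ (fun i => (2 : ℂ) ^ vExp (4 * m) i) _, ?_, ?_⟩
  · refine dk_totalDegree_lift m 16 _ (fun i => (2 : ℂ) ^ vExp (4 * m) i)
      (fun i j => (⟨i / 16 ^ (j : ℕ) % 16, Nat.mod_lt _ (by norm_num)⟩ : Fin 16)) 0
      (Finset.mem_range.2 (by positivity)) (fun i hi hd0 => ?_) (pow_ne_zero _ two_ne_zero)
    have h := hdig i hi
    have h0 : ∀ j : Fin m, i / 16 ^ (j : ℕ) % 16 = 0 := fun j => by
      have := congrArg (fun f => ((f j : Fin 16) : ℕ)) hd0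
      simpa using this
    rw [← h]
    exact Finset.sum_eq_zero fun j _ => by simp [h0 j]
  · rw [dk_aeval_lift m 16 _ (fun i => (2 : ℂ) ^ vExp (4 * m) i) _ hdig, TavenasVn.map_tavenasV' ℂ (4 * m)]
    have h16 : (16 : ℕ) ^ m = 2 ^ (4 * m) := by rw [pow_mul]; norm_num
    rw [h16]

end Summit.ValiantsHypothesis.ValiantsHypothesis.Theorems.SOSTauHutchinsonMagnification

end
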